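import Literature.Analysis.FluidPDE.LambertCosineLaw
import Literature.MathematicalPhysics.KineticTheory.PostCollisionGeometry
import HarnessLib

/-!
# Gaussian flux integrals over the sphere of `ℝ³` decay like the inverse speed

Elementary angular estimates on the unit sphere `S² ⊆ ℝ³` with its surface measure
`σ = volume.toSphere`, in the form needed by the weighted sup-norm theory of the linearised hard-sphere
operator (Grad 1963, Guo 2010): for `v ≠ 0` and `θ > 0`,

* `lintegral_toSphere_cos_mul_exp_neg_le` — `∫ ⟪a, ν⟫₊ e^{-c⟪a, ν⟫²} dσ(ν) ≤ π / c` for a unit `a`: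
  Archimedes' hat-box theorem in flux form (`lintegral_toSphere_cos_comp_coords`: the cosine law is the
  lift of the uniform disc law) reduces it to `∫_{|p|<1} e^{-c(1-|p|²)} dp = π (1 - e^{-c})/c`
  (`setLIntegral_ball_exp_neg_mul_one_sub_norm_sq_le`, polar coordinates in `ℝ²`);
* `lintegral_toSphere_abs_inner_mul_exp_neg_le_div` — `∫ |⟪v, ν⟫| e^{-θ⟪v, ν⟫²} dσ(ν) ≤ 2π/(θ|v|)`;
* `toSphere_abs_inner_le_one_le` — the equatorial band `{|⟪v, ν⟫| ≤ 1}` has measure `≤ 512π/|v|`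
  (`toSphere_band_le`);
* `lintegral_toSphere_abs_inner_add_mul_exp_neg_le` — the combination
  `∫ (|⟪v, ν⟫| + r) e^{-θ⟪v, ν⟫²} dσ(ν) ≤ (2π(1 + r)/θ + 512π r)/|v|`.

Constants are explicit but not optimised. No new definitions are introduced.
-/

noncomputable section

open scoped ENNReal InnerProductSpace
open MeasureTheory Set Filter Metric Real

namespace Literature.Analysis.FluidPDE

/-! ### The planar integral `∫_{|p|<1} e^{-c(1-|p|²)} dp ≤ π / c` -/

/-- `∫₀¹ y e^{-c(1-y²)} dy = (1 - e^{-c})/(2c)` (the integrand is the derivative of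
`e^{-c(1-y²)}/(2c)`). [folklore] -/
theorem integral_mul_exp_neg_mul_one_sub_sq {c : ℝ} (hc : 0 < c) :
    ∫ y in (0 : ℝ)..1, y * Real.exp (-c * (1 - y ^ 2)) = (1 - Real.exp (-c)) / (2 * c) := by
  have hderiv : ∀ y ∈ uIcc (0 : ℝ) 1,
      HasDerivAt (fun y => Real.exp (-c * (1 - y ^ 2)) / (2 * c)) (y * Real.exp (-c * (1 - y ^ 2))) y := by
    intro y _
    have hsq : HasDerivAt (fun x : ℝ => x ^ 2) (2 * y) y := by simpa using hasDerivAt_pow 2 y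
    have h1 : HasDerivAt (fun x : ℝ => -c * (1 - x ^ 2)) (2 * c * y) y :=
      ((hsq.const_sub 1).const_mul (-c)).congr_deriv (by ring)
    have h2c : (2 : ℝ) * c ≠ 0 := by positivity
    exact (h1.exp.div_const (2 * c)).congr_deriv (by field_simp)
  rw [intervalIntegral.integral_eq_sub_of_hasDerivAt hderiv
    ((by fun_prop : Continuous fun y : ℝ => y * Real.exp (-c * (1 - y ^ 2))).intervalIntegrable 0 1)]
  simp only [one_pow, sub_self, mul_zero, Real.exp_zero, ne_eq, OfNat.ofNat_ne_zero, not_false_eq_true,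
    zero_pow, sub_zero, mul_one]
  ring

/-- **`∫_{|p| < 1} e^{-c(1-|p|²)} dp ≤ π/c` on `ℝ²`** (polar coordinates: the integral is
`2π ∫₀¹ y e^{-c(1-y²)} dy = π (1 - e^{-c})/c`). [folklore] -/
theorem setLIntegral_ball_exp_neg_mul_one_sub_norm_sq_le {c : ℝ} (hc : 0 < c) :
    ∫⁻ p in ball (0 : EuclideanSpace ℝ (Fin 2)) 1, ENNReal.ofReal (Real.exp (-c * (1 - ‖p‖ ^ 2))) ≤
      ENNReal.ofReal (Real.pi / c) := by
  set G : ℝ → ℝ := fun y => Real.exp (-c * (1 - y ^ 2)) with hG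
  have hGc : Continuous G := by rw [hG]; fun_prop
  -- the set integral as an integral of a radial function
  have hrad : ∀ p : EuclideanSpace ℝ (Fin 2), (ball (0 : EuclideanSpace ℝ (Fin 2)) 1).indicator
      (fun p => G ‖p‖) p = (Iio (1 : ℝ)).indicator G ‖p‖ := by
    intro p
    by_cases hp : p ∈ ball (0 : EuclideanSpace ℝ (Fin 2)) 1
    · have hp' : ‖p‖ ∈ Iio (1 : ℝ) := by simpa using hp
      rw [indicator_of_mem hp, indicator_of_mem hp']
    · have hp' : ‖p‖ ∉ Iio (1 : ℝ) := by simpa using hp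
      rw [indicator_of_notMem hp, indicator_of_notMem hp']
  have hint : IntegrableOn (fun p : EuclideanSpace ℝ (Fin 2) => G ‖p‖) (ball 0 1) volume :=
    ((hGc.comp continuous_norm).continuousOn.integrableOn_compact
      (isCompact_closedBall (0 : EuclideanSpace ℝ (Fin 2)) 1)).mono_set ball_subset_closedBall
  have hnn : 0 ≤ᵐ[volume.restrict (ball (0 : EuclideanSpace ℝ (Fin 2)) 1)]
      fun p : EuclideanSpace ℝ (Fin 2) => G ‖p‖ := Eventually.of_forall fun p => Real.exp_nonneg _
  rw [← ofReal_integral_eq_lintegral_ofReal hint hnn]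
  refine ENNReal.ofReal_le_ofReal ?_
  rw [← integral_indicator measurableSet_ball, funext hrad,
    integral_fun_norm_addHaar (volume : Measure (EuclideanSpace ℝ (Fin 2))) ((Iio (1 : ℝ)).indicator G)]
  -- the radial integral
  have h1d : ∫ y in Ioi (0 : ℝ), y ^ (Module.finrank ℝ (EuclideanSpace ℝ (Fin 2)) - 1) • (Iio (1 : ℝ)).indicator G y =
      (1 - Real.exp (-c)) / (2 * c) := by
    rw [finrank_euclideanSpace_fin, show 2 - 1 = 1 from rfl]
    simp only [pow_one, smul_eq_mul]
    have hind : ∀ y : ℝ, y * (Iio (1 : ℝ)).indicator G y = (Iio (1 : ℝ)).indicator (fun y => y * G y) y := by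
      intro y
      by_cases hy : y ∈ Iio (1 : ℝ)
      · rw [indicator_of_mem hy, indicator_of_mem hy]
      · rw [indicator_of_notMem hy, indicator_of_notMem hy, mul_zero]
    simp_rw [hind]
    rw [setIntegral_indicator measurableSet_Iio, show Ioi (0 : ℝ) ∩ Iio 1 = Ioo 0 1 from rfl,
      ← integral_Ioc_eq_integral_Ioo, ← intervalIntegral.integral_of_le zero_le_one,
      integral_mul_exp_neg_mul_one_sub_sq hc]
  rw [h1d, finrank_euclideanSpace_fin, Measure.real, EuclideanSpace.volume_ball_fin_two,
    ENNReal.ofReal_one, one_pow, one_mul, ENNReal.toReal_ofReal Real.pi_pos.le, nsmul_eq_mul, smul_eq_mul]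
  have hexp : 0 ≤ Real.exp (-c) := Real.exp_nonneg _
  rw [show (2 : ℕ) * (Real.pi * ((1 - Real.exp (-c)) / (2 * c))) = Real.pi / c * (1 - Real.exp (-c)) by
    push_cast; field_simp]
  exact mul_le_of_le_one_right (by positivity) (by linarith)

/-! ### The Gaussian flux through the sphere -/

/-- **Archimedes' hat-box theorem for a Gaussian flux weight**: for a unit vector `a` of `ℝ³` and
`c > 0`, `∫_{S²} ⟪a, ν⟫₊ e^{-c ⟪a, ν⟫²} dσ(ν) ≤ π / c` (the flux law pushes `⟪a, ν⟫²` forward to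
`1 - |p|²` on the unit disc, `lintegral_toSphere_cos_comp_coords`). [folklore] -/
theorem lintegral_toSphere_cos_mul_exp_neg_le {a : EuclideanSpace ℝ (Fin 3)} (ha : ‖a‖ = 1) {c : ℝ}
    (hc : 0 < c) :
    ∫⁻ ν : sphere (0 : EuclideanSpace ℝ (Fin 3)) 1, ENNReal.ofReal ⟪a, (ν : EuclideanSpace ℝ (Fin 3))⟫_ℝ *
        ENNReal.ofReal (Real.exp (-c * ⟪a, (ν : EuclideanSpace ℝ (Fin 3))⟫_ℝ ^ 2)) ∂(volume.toSphere) ≤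
      ENNReal.ofReal (Real.pi / c) := by
  have hf : Measurable fun p : EuclideanSpace ℝ (Fin 2) => ENNReal.ofReal (Real.exp (-c * (1 - ‖p‖ ^ 2))) :=
    (by fun_prop : Continuous fun p : EuclideanSpace ℝ (Fin 2) => Real.exp (-c * (1 - ‖p‖ ^ 2))).measurable.ennreal_ofReal
  have h := lintegral_toSphere_cos_comp_coords ha hf
  have hpt : ∀ ν : sphere (0 : EuclideanSpace ℝ (Fin 3)) 1,
      Real.exp (-c * (1 - ‖Lambert.coords a ν‖ ^ 2)) = Real.exp (-c * ⟪a, (ν : EuclideanSpace ℝ (Fin 3))⟫_ℝ ^ 2) := by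
    intro ν
    rw [Lambert.norm_sq_coords ha, norm_eq_of_mem_sphere ν]
    ring_nf
  simp_rw [hpt] at h
  rw [h]
  exact setLIntegral_ball_exp_neg_mul_one_sub_norm_sq_le hc

/-- `|t| = t₊ + (-t)₊` in `ℝ≥0∞`. [folklore] -/
theorem ofReal_abs_eq_posPart_add_negPart (t : ℝ) : ENNReal.ofReal |t| = ENNReal.ofReal t + ENNReal.ofReal (-t) := by
  rcases le_total 0 t with h | h
  · rw [abs_of_nonneg h, ENNReal.ofReal_of_nonpos (neg_nonpos.2 h), add_zero]
  · rw [abs_of_nonpos h, ENNReal.ofReal_of_nonpos h, zero_add]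

/-- **Two-sided Gaussian flux**: `∫_{S²} |⟪a, ν⟫| e^{-c⟪a, ν⟫²} dσ(ν) ≤ 2π / c` for a unit vector `a`
and `c > 0`. [folklore] -/
theorem lintegral_toSphere_abs_inner_mul_exp_neg_le {a : EuclideanSpace ℝ (Fin 3)} (ha : ‖a‖ = 1) {c : ℝ}
    (hc : 0 < c) :
    ∫⁻ ν : sphere (0 : EuclideanSpace ℝ (Fin 3)) 1, ENNReal.ofReal (|⟪a, (ν : EuclideanSpace ℝ (Fin 3))⟫_ℝ| *
        Real.exp (-c * ⟪a, (ν : EuclideanSpace ℝ (Fin 3))⟫_ℝ ^ 2)) ∂(volume.toSphere) ≤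
      ENNReal.ofReal (2 * Real.pi / c) := by
  have ha' : ‖-a‖ = 1 := by rw [norm_neg, ha]
  have h1 := lintegral_toSphere_cos_mul_exp_neg_le ha hc
  have h2 := lintegral_toSphere_cos_mul_exp_neg_le ha' hc
  have hmeas : Measurable fun ν : sphere (0 : EuclideanSpace ℝ (Fin 3)) 1 =>
      ENNReal.ofReal ⟪a, (ν : EuclideanSpace ℝ (Fin 3))⟫_ℝ *
        ENNReal.ofReal (Real.exp (-c * ⟪a, (ν : EuclideanSpace ℝ (Fin 3))⟫_ℝ ^ 2)) := by
    have hi : Continuous fun ν : sphere (0 : EuclideanSpace ℝ (Fin 3)) 1 => ⟪a, (ν : EuclideanSpace ℝ (Fin 3))⟫_ℝ :=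
      continuous_const.inner continuous_subtype_val
    exact hi.measurable.ennreal_ofReal.mul (by fun_prop : Continuous fun ν : sphere (0 : EuclideanSpace ℝ (Fin 3)) 1 =>
      Real.exp (-c * ⟪a, (ν : EuclideanSpace ℝ (Fin 3))⟫_ℝ ^ 2)).measurable.ennreal_ofReal
  have hsplit : ∀ ν : sphere (0 : EuclideanSpace ℝ (Fin 3)) 1,
      ENNReal.ofReal (|⟪a, (ν : EuclideanSpace ℝ (Fin 3))⟫_ℝ| * Real.exp (-c * ⟪a, (ν : EuclideanSpace ℝ (Fin 3))⟫_ℝ ^ 2)) =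
        ENNReal.ofReal ⟪a, (ν : EuclideanSpace ℝ (Fin 3))⟫_ℝ *
            ENNReal.ofReal (Real.exp (-c * ⟪a, (ν : EuclideanSpace ℝ (Fin 3))⟫_ℝ ^ 2)) +
          ENNReal.ofReal ⟪-a, (ν : EuclideanSpace ℝ (Fin 3))⟫_ℝ *
            ENNReal.ofReal (Real.exp (-c * ⟪-a, (ν : EuclideanSpace ℝ (Fin 3))⟫_ℝ ^ 2)) := by
    intro ν
    rw [ENNReal.ofReal_mul (abs_nonneg _), ofReal_abs_eq_posPart_add_negPart, add_mul, inner_neg_left, neg_sq]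
  simp_rw [hsplit]
  rw [lintegral_add_left hmeas]
  calc _ ≤ ENNReal.ofReal (Real.pi / c) + ENNReal.ofReal (Real.pi / c) := add_le_add h1 h2
    _ = ENNReal.ofReal (2 * Real.pi / c) := by
        rw [← ENNReal.ofReal_add (by positivity) (by positivity)]; ring_nf

/-- **The Gaussian-damped flux decays like the inverse speed**: for `v ≠ 0` and `θ > 0`,
`∫_{S²} |⟪v, ν⟫| e^{-θ⟪v, ν⟫²} dσ(ν) ≤ 2π / (θ |v|)` (scale `a = v/|v|`, `c = θ|v|²`). [folklore] -/
theorem lintegral_toSphere_abs_inner_mul_exp_neg_le_div {v : EuclideanSpace ℝ (Fin 3)} (hv : v ≠ 0) {θ : ℝ}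
    (hθ : 0 < θ) :
    ∫⁻ ν : sphere (0 : EuclideanSpace ℝ (Fin 3)) 1, ENNReal.ofReal (|⟪v, (ν : EuclideanSpace ℝ (Fin 3))⟫_ℝ| *
        Real.exp (-θ * ⟪v, (ν : EuclideanSpace ℝ (Fin 3))⟫_ℝ ^ 2)) ∂(volume.toSphere) ≤
      ENNReal.ofReal (2 * Real.pi / (θ * ‖v‖)) := by
  have hvn : 0 < ‖v‖ := norm_pos_iff.2 hv
  set a : EuclideanSpace ℝ (Fin 3) := ‖v‖⁻¹ • v with ha_def
  have ha : ‖a‖ = 1 := by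
    rw [ha_def, norm_smul, norm_inv, norm_norm, inv_mul_cancel₀ hvn.ne']
  have hva : v = ‖v‖ • a := by rw [ha_def, smul_smul, mul_inv_cancel₀ hvn.ne', one_smul]
  have hc : 0 < θ * ‖v‖ ^ 2 := by positivity
  have h := lintegral_toSphere_abs_inner_mul_exp_neg_le ha hc
  have hpt : ∀ ν : sphere (0 : EuclideanSpace ℝ (Fin 3)) 1,
      ENNReal.ofReal (|⟪v, (ν : EuclideanSpace ℝ (Fin 3))⟫_ℝ| * Real.exp (-θ * ⟪v, (ν : EuclideanSpace ℝ (Fin 3))⟫_ℝ ^ 2)) =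
        ENNReal.ofReal ‖v‖ * ENNReal.ofReal (|⟪a, (ν : EuclideanSpace ℝ (Fin 3))⟫_ℝ| *
          Real.exp (-(θ * ‖v‖ ^ 2) * ⟪a, (ν : EuclideanSpace ℝ (Fin 3))⟫_ℝ ^ 2)) := by
    intro ν
    rw [← ENNReal.ofReal_mul hvn.le]
    congr 1
    conv_lhs => rw [hva]
    rw [real_inner_smul_left, abs_mul, abs_of_pos hvn]
    ring_nf
  simp_rw [hpt]
  rw [lintegral_const_mul' _ _ ENNReal.ofReal_ne_top]
  calc ENNReal.ofReal ‖v‖ * _ ≤ ENNReal.ofReal ‖v‖ * ENNReal.ofReal (2 * Real.pi / (θ * ‖v‖ ^ 2)) :=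
        mul_le_mul' le_rfl h
    _ = ENNReal.ofReal (2 * Real.pi / (θ * ‖v‖)) := by
        rw [← ENNReal.ofReal_mul hvn.le]
        congr 1
        field_simp

/-! ### The equatorial band and the combined bound -/

/-- **The equatorial band `|⟪v, ν⟫| ≤ 1` of the sphere of `ℝ³` has measure `≤ 512π / |v|`**
(`toSphere_band_le` with half-width `2/|v|`). [folklore] -/
theorem toSphere_abs_inner_le_one_le {v : EuclideanSpace ℝ (Fin 3)} (hv : v ≠ 0) :
    volume.toSphere {ν : sphere (0 : EuclideanSpace ℝ (Fin 3)) 1 | |⟪v, (ν : EuclideanSpace ℝ (Fin 3))⟫_ℝ| ≤ 1} ≤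
      ENNReal.ofReal (512 * Real.pi / ‖v‖) := by
  have hvn : 0 < ‖v‖ := norm_pos_iff.2 hv
  set a : EuclideanSpace ℝ (Fin 3) := ‖v‖⁻¹ • v with ha_def
  have ha : ‖a‖ = 1 := by
    rw [ha_def, norm_smul, norm_inv, norm_norm, inv_mul_cancel₀ hvn.ne']
  have hsub : {ν : sphere (0 : EuclideanSpace ℝ (Fin 3)) 1 | |⟪v, (ν : EuclideanSpace ℝ (Fin 3))⟫_ℝ| ≤ 1} ⊆
      {ν : sphere (0 : EuclideanSpace ℝ (Fin 3)) 1 | |⟪(ν : EuclideanSpace ℝ (Fin 3)), a⟫_ℝ| < 2 / ‖v‖} := by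
    intro ν hν
    simp only [mem_setOf_eq] at hν ⊢
    rw [ha_def, real_inner_smul_right, real_inner_comm, abs_mul, abs_of_pos (inv_pos.2 hvn)]
    calc ‖v‖⁻¹ * |⟪v, (ν : EuclideanSpace ℝ (Fin 3))⟫_ℝ| ≤ ‖v‖⁻¹ * 1 :=
          mul_le_mul_of_nonneg_left hν (inv_nonneg.2 hvn.le)
      _ < 2 / ‖v‖ := by rw [mul_one, lt_div_iff₀ hvn, inv_mul_cancel₀ hvn.ne']; norm_num
  have hband := Literature.MathematicalPhysics.KineticTheory.toSphere_band_le
    (volume : Measure (EuclideanSpace ℝ (Fin 3))) ha (lam := 2 / ‖v‖) (by positivity)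
    (by rw [finrank_euclideanSpace_fin]; norm_num)
  refine (measure_mono hsub).trans (hband.trans (le_of_eq ?_))
  rw [finrank_euclideanSpace_fin, EuclideanSpace.volume_ball_fin_three, ENNReal.ofReal_one, one_pow, one_mul,
    ← ENNReal.ofReal_mul (by positivity)]
  congr 1
  push_cast
  field_simp
  ring

/-- **Combined bound**: for `v ≠ 0`, `θ > 0` and `r ≥ 0`,
`∫_{S²} (|⟪v, ν⟫| + r) e^{-θ⟪v, ν⟫²} dσ(ν) ≤ (2π (1 + r)/θ + 512π r) / |v|`
(`e^{-θ t²} ≤ 1_{|t| ≤ 1} + |t| e^{-θt²}`, the flux bound and the band bound). This is the angular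
estimate behind the decay `(ν⁻¹ K₂ e^{θ|·|²})(v) = O(|v|⁻²) e^{θ|v|²}` of the hard-sphere gain operator on
Gaussian weights. [folklore] -/
theorem lintegral_toSphere_abs_inner_add_mul_exp_neg_le {v : EuclideanSpace ℝ (Fin 3)} (hv : v ≠ 0) {θ r : ℝ}
    (hθ : 0 < θ) (hr : 0 ≤ r) :
    ∫⁻ ν : sphere (0 : EuclideanSpace ℝ (Fin 3)) 1, ENNReal.ofReal ((|⟪v, (ν : EuclideanSpace ℝ (Fin 3))⟫_ℝ| + r) *
        Real.exp (-θ * ⟪v, (ν : EuclideanSpace ℝ (Fin 3))⟫_ℝ ^ 2)) ∂(volume.toSphere) ≤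
      ENNReal.ofReal ((2 * Real.pi * (1 + r) / θ + 512 * Real.pi * r) / ‖v‖) := by
  have hvn : 0 < ‖v‖ := norm_pos_iff.2 hv
  set B : Set (sphere (0 : EuclideanSpace ℝ (Fin 3)) 1) :=
    {ν | |⟪v, (ν : EuclideanSpace ℝ (Fin 3))⟫_ℝ| ≤ 1} with hB
  have hBm : MeasurableSet B :=
    measurableSet_le (continuous_const.inner continuous_subtype_val).abs.measurable measurable_const
  -- pointwise: `(|t| + r) e ≤ (1 + r) |t| e + r 1_B`
  set F : sphere (0 : EuclideanSpace ℝ (Fin 3)) 1 → ℝ≥0∞ := fun ν =>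
    ENNReal.ofReal (|⟪v, (ν : EuclideanSpace ℝ (Fin 3))⟫_ℝ| * Real.exp (-θ * ⟪v, (ν : EuclideanSpace ℝ (Fin 3))⟫_ℝ ^ 2))
    with hF
  have hFm : Measurable F := by
    have hi : Continuous fun ν : sphere (0 : EuclideanSpace ℝ (Fin 3)) 1 => ⟪v, (ν : EuclideanSpace ℝ (Fin 3))⟫_ℝ :=
      continuous_const.inner continuous_subtype_val
    exact (by fun_prop : Continuous fun ν : sphere (0 : EuclideanSpace ℝ (Fin 3)) 1 =>
      |⟪v, (ν : EuclideanSpace ℝ (Fin 3))⟫_ℝ| * Real.exp (-θ * ⟪v, (ν : EuclideanSpace ℝ (Fin 3))⟫_ℝ ^ 2)).measurable.ennreal_ofReal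
  have hpt : ∀ ν : sphere (0 : EuclideanSpace ℝ (Fin 3)) 1,
      ENNReal.ofReal ((|⟪v, (ν : EuclideanSpace ℝ (Fin 3))⟫_ℝ| + r) *
        Real.exp (-θ * ⟪v, (ν : EuclideanSpace ℝ (Fin 3))⟫_ℝ ^ 2)) ≤
        ENNReal.ofReal (1 + r) * F ν + ENNReal.ofReal r * B.indicator 1 ν := by
    intro ν
    set t : ℝ := ⟪v, (ν : EuclideanSpace ℝ (Fin 3))⟫_ℝ with ht
    have he0 : 0 ≤ Real.exp (-θ * t ^ 2) := Real.exp_nonneg _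
    have he1 : Real.exp (-θ * t ^ 2) ≤ 1 := Real.exp_le_one_iff.2 (by nlinarith [sq_nonneg t])
    by_cases hmem : ν ∈ B
    · rw [indicator_of_mem hmem, Pi.one_apply, mul_one, hF]
      dsimp only
      rw [← ht, ← ENNReal.ofReal_mul (by positivity), ← ENNReal.ofReal_add (by positivity) hr]
      refine ENNReal.ofReal_le_ofReal ?_
      have : |t| * Real.exp (-θ * t ^ 2) ≥ 0 := by positivity
      nlinarith [abs_nonneg t, mul_nonneg hr he0, mul_nonneg hr (abs_nonneg t)]
    · have ht1 : 1 < |t| := by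
        by_contra h; exact hmem (not_lt.1 h)
      rw [indicator_of_notMem hmem, mul_zero, add_zero, hF]
      dsimp only
      rw [← ht, ← ENNReal.ofReal_mul (by positivity)]
      refine ENNReal.ofReal_le_ofReal ?_
      nlinarith [mul_nonneg hr he0, abs_nonneg t, mul_le_mul_of_nonneg_right ht1.le (mul_nonneg hr he0)]
  refine (lintegral_mono hpt).trans ?_
  rw [lintegral_add_left ((hFm.const_mul _)), lintegral_const_mul _ hFm,
    lintegral_const_mul _ (measurable_one.indicator hBm), lintegral_indicator_one hBm]
  have h1 := lintegral_toSphere_abs_inner_mul_exp_neg_le_div hv hθ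
  have h2 := toSphere_abs_inner_le_one_le hv
  calc ENNReal.ofReal (1 + r) * ∫⁻ ν, F ν ∂volume.toSphere + ENNReal.ofReal r * volume.toSphere B
      ≤ ENNReal.ofReal (1 + r) * ENNReal.ofReal (2 * Real.pi / (θ * ‖v‖)) +
          ENNReal.ofReal r * ENNReal.ofReal (512 * Real.pi / ‖v‖) :=
        add_le_add (mul_le_mul' le_rfl h1) (mul_le_mul' le_rfl h2)
    _ = ENNReal.ofReal ((2 * Real.pi * (1 + r) / θ + 512 * Real.pi * r) / ‖v‖) := by
        rw [← ENNReal.ofReal_mul (by positivity), ← ENNReal.ofReal_mul hr,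
          ← ENNReal.ofReal_add (by positivity) (by positivity)]
        congr 1
        field_simp

end Literature.Analysis.FluidPDE

end
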